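/-
Copyright (c) 2026 the pub-hodgecm-mathlib formalisation cell (harness21).  Prover seat hodgecm-mathlib-K2E5-p11 (g2): Track B «K2-LIT», engine E3, line (ii′)
«H-side central germ expansion», leaf (E) `sig_K2E3CentralGermExpansionExistence`, sub-leaf (RAO_z), brick «RAO-CONV_z» (cut by K2E3-p23 (g2) 2026-09-04), FILE B.
-/
import Literature.NumberTheory.Rogawski1990.UnipotentOrbitalIntegralConvergenceSingularCM      -- ★ N = 3 pattern p849314∕p849351: `descConj`, ★ `InvariantQuotientAdaptedUnfoldingBound`, ★ `OrbitalFinitenessTransport`, Iwasawa, `IsLocSmooth`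
import Literature.NumberTheory.Rogawski1990.UnitaryTwoOneCentralUnipotentOrbitalMeasuresCM       -- ★ p856037 (K2E3-p23 (g2)) «RAO-EX_z»: brings the N = 2 dictionary ★ p855844 and strata ★ p855879 (`fst_comm_of_mem_center`)
import Literature.NumberTheory.Rogawski1990.LocalTransferUnmatchedLocus                          -- ★ `compactSpace_cmDatum_local_one_of_smul_eq` (`U(Φ₁)(L⁺_v)` is compact at a non-split `v`)
import Literature.NumberTheory.Automorphic.LocalOrbitalMeasureRegular                            -- ★ `isMulRightInvariant_localEndoscopic` (`H_v = U(Φ₂) × U(Φ₁)` is unimodular)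
import Literature.NumberTheory.Automorphic.UnitaryTwoCartanAnyInvolution                         -- ★ `Two.mem_glInt_iff_forall_v_le_one` (`K₀ = U ∩ GL₂(𝒪)` is cut out by the entries)
import Literature.NumberTheory.Automorphic.UnitaryTwoLineUnipotentBorelConjugation               -- FILE A (this seat): 2×2 field level — `b n(t) b⁻¹ = n(t b₀₀ σb₀₀)`, `d(ϖ)`-conjugation, integrality
import HarnessLib

/-!
# Ranga Rao at the regular-unipotent classes over a central `z` of `H_v = U(Φ₂)(L⁺_v) × U(Φ₁)(L⁺_v)` — finiteness of orbit-preimages of compacta («RAO-CONV_z», FILE B)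

Cell map: H413 «K2-LIT», E3 line (ii′) «H-side central germ expansion», leaf **(E) `sig_K2E3CentralGermExpansionExistence`**, sub-leaf (RAO_z)
`sig_K2E3CentralUnipotentOrbitalMeasures` ⟸ ★ p856062 ∘ **(RAO-CONV_z) `sig_K2E3CentralUnipotentOrbitalConvergence`** (cand 35641b1af515a2eb, K2E3-p23 (g2) for this seat).
This file is the CORE of (RAO-CONV_z): the rank-one (`N = 2`) × abelian, CENTRED twin of ★ p849314
`UnitaryGroup.measure_preimage_descConj_lt_top_of_coe_eq_cornerUnipotent` (`N = 3`).

THE MATHEMATICS.  `v` a finite place of `L⁺` non-split in the CM field `L` (`w ∣ v`, `c • w = w`), `G₂ = U(Φ₂)(L⁺_v) ≅ U(1,1)(L_w ∕ L⁺_v)` through the one-place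
dictionary `ψ` (★ p855844, frame `T = 1`), `G₁ = U(Φ₁)(L⁺_v) = L_w^{N=1}` (compact, abelian), `H_v = G₂ × G₁`, `z ∈ Z(H_v)`, `u ∈ G₂` with `ψ u = n(t₀) = (1, t₀; 0, 1)`,
`t₀ ≠ 0` (so `σt₀ = −t₀`), `γ₀ = (u, 1)·z`.  Then `Z(γ₀) = Z_{G₂}(u) × G₁` and `h ∈ Z(γ₀) ⟺ ψ(h₁)₁₀ = 0 ∧ ψ(h₁)₀₀ = ψ(h₁)₁₁` (★ `mul_lineUnipotent_eq_lineUnipotent_mul_iff`).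
With `K = U(Φ₂)(𝒪_v) × G₁` (compact open) and `a = (ψ⁻¹ d(ϖ), 1)`, `d(ϖ) = diag(ϖ, (σϖ)⁻¹)`: `a` normalises `Z(γ₀)`, `Ad a` improves `K`-integrality on `Z(γ₀)`
(`d(ϖ)(α, β; 0, α)d(ϖ)⁻¹ = (α, ϖσϖ·β; 0, α)`) STRICTLY (witness `ψ⁻¹ n(s)`, `s = t₀ (ϖσϖ)^k` skew with `1 < |s| ≤ |ϖ|⁻²`).  COVERING: if `y γ₀ y⁻¹ ∈ C` then, writing
`y₁ = κ b` (Iwasawa ★ `exists_mem_cmLocalIntegralLevel_mul_borel`, `b` upper triangular), `ψ(b u b⁻¹) = n(t₀ b₀₀ σb₀₀) ∈ ψ(K₂ C₂ K₂)` (`C₂ = pr₁(C)·z₁⁻¹` compact) bounds the level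
`n₀ = −log_q|b₀₀|` from above, and `y Z(γ₀) ∈ π(K a^{−n₀})` (`n₀ ≤ 0`) or `∈ π(K (ψ⁻¹d(ϖ^{n₀}), 1))` (`0 < n₀ ≤ n_C`).  MEASURE: ★ `measure_iUnion_image_mk_mul_zpow_lt_top` (the shells along
`a`) + ★ `measure_image_mk_mul_singleton_lt_top` (finitely many), over `H_v` unimodular (★ `isMulRightInvariant_localEndoscopic`).  No parity ∕ residue-characteristic hypothesis.

* `UnitaryGroup.measure_preimage_descConj_lt_top_of_coe_eq_lineUnipotent_central` — THE CORE: for every `H_v`-invariant measure `μ` on `H_v ⧸ Z(γ₀)` finite on compacta and every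
  compact `C ⊆ H_v`, `μ {y Z(γ₀) ∣ y γ₀ y⁻¹ ∈ C} < ∞` (head published as cand `measure_preimage_descConj_lt_top_of_coe_eq_lineUnipotent_central.cand.K2E5-p11-g2.lean` 815f12adebd99e25).
* `UnitaryGroup.integrable_descConj_of_isLocSmooth_of_coe_eq_lineUnipotent_central` — the Rao clause at the base point: `y Z(γ₀) ↦ f(y γ₀ y⁻¹)` is `μ`-integrable for `f ∈ C_c^∞(H_v)`.

THEOREMS ONLY; count-neutral ★ brick `--supports stmt-HodgeConjecture-24833`.  HONEST LABEL: HC_CM is proved only modulo the 7 printed citations (2 remaining named inputs: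
hLiu418 = stmt-HodgeConjecture-24832, h413 = stmt-HodgeConjecture-24833) until rung 0 closes.

## References
* [Rao1972] R. Ranga Rao, *Orbital integrals in reductive groups*, Ann. of Math. (2) 96 (1972) 505–510, Theorem p. 505.
* [Rogawski1990] J. D. Rogawski, *Automorphic Representations of Unitary Groups in Three Variables*, Ann. of Math. Stud. 123 (1990): §1.10 p. 9, §3.9 p. 32, §4.9 p. 54 (the
  endoscopic group `H = U(2) × U(1)`), §8.1 p. 112 (unipotent orbital integrals).
* [HarishChandra1999AdmissibleDistributions] Harish-Chandra, *Admissible Invariant Distributions on Reductive p-adic Groups* (1999), §3.1 p. 17; [BruhatTits1972] (4.4.3).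
-/

set_option autoImplicit false

noncomputable section

open scoped Matrix MatrixGroups Valued WithZero ENNReal Pointwise
open Matrix MeasureTheory Topology Set NumberField IsDedekindDomain

namespace Literature.NumberTheory.Rogawski1990

open Literature.NumberTheory.Automorphic Literature.NumberTheory.Automorphic.UnitaryGroup Literature.NumberTheory.GaloisRepresentations
open Literature.NumberTheory.Automorphic.UnitaryLatticeTree Literature.NumberTheory.Automorphic.HermitianLattice Literature.MeasureTheory.Group

set_option maxHeartbeats 3200000 in
-- one long covering argument through the dictionary `ψ` on the product carrier (twin of ★ p849314, same budget)
/-- **RANGA RAO AT THE REGULAR-UNIPOTENT CLASSES OVER A CENTRAL `z` OF `H_v = U(Φ₂)(L⁺_v) × U(Φ₁)(L⁺_v)` — FINITENESS OF ORBIT-PREIMAGES OF COMPACTA.**  At a non-split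
place `v` of `L⁺` (`w ∣ v` fixed by complex conjugation), for `z ∈ Z(H_v)` and `u ∈ U(Φ₂)(L⁺_v)` whose one-place matrix is `n(t₀) = (1, t₀; 0, 1)` (`t₀ ≠ 0`), EVERY
`H_v`-invariant measure `μ` on `H_v ⧸ Z((u,1)·z)` finite on compacta gives finite mass to `{y Z ∣ y (u,1) z y⁻¹ ∈ C}` for every compact `C ⊆ H_v`.  Proof: the `U(1,1)`
Iwasawa covering `⊆ ⋃_{m ≥ 0} π(K a^m) ∪ ⋃_{n ≤ n_C} π(K g_n)` (`K = U(Φ₂)(𝒪_v) × U(Φ₁)(L⁺_v)`, `a = (ψ⁻¹ d(ϖ), 1)`), ★ `measure_iUnion_image_mk_mul_zpow_lt_top` and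
★ `measure_image_mk_mul_singleton_lt_top`; rank-one × abelian centred twin of ★ `UnitaryGroup.measure_preimage_descConj_lt_top_of_coe_eq_cornerUnipotent`.
[cite: Rao1972, Theorem p. 505] [cite: Rogawski1990, §3.9 p. 32; §4.9 p. 54; §8.1 p. 112] [cite: HarishChandra1999AdmissibleDistributions, §3.1 p. 17] [cite: BruhatTits1972, (4.4.3)] -/
theorem UnitaryGroup.measure_preimage_descConj_lt_top_of_coe_eq_lineUnipotent_central
    (L : Type) [Field L] [NumberField L] [IsCMField L] (v : HeightOneSpectrum (𝓞 ↥(maximalRealSubfield L)))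
    (w : PlacesOver L v) (hw : IsCMField.complexConj L • w.1 = w.1)
    [MeasurableSpace ((cmDatum L 2 (Matrix.of fun i j : Fin 2 => if i.val + j.val + 1 = 2 then (1 : L) else 0)).Local v × (cmDatum L 1 (Matrix.of fun i j : Fin 1 => if i.val + j.val + 1 = 1 then (1 : L) else 0)).Local v)] [BorelSpace ((cmDatum L 2 (Matrix.of fun i j : Fin 2 => if i.val + j.val + 1 = 2 then (1 : L) else 0)).Local v × (cmDatum L 1 (Matrix.of fun i j : Fin 1 => if i.val + j.val + 1 = 1 then (1 : L) else 0)).Local v)]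
    [∀ γ : (cmDatum L 2 (Matrix.of fun i j : Fin 2 => if i.val + j.val + 1 = 2 then (1 : L) else 0)).Local v × (cmDatum L 1 (Matrix.of fun i j : Fin 1 => if i.val + j.val + 1 = 1 then (1 : L) else 0)).Local v, MeasurableSpace (((cmDatum L 2 (Matrix.of fun i j : Fin 2 => if i.val + j.val + 1 = 2 then (1 : L) else 0)).Local v × (cmDatum L 1 (Matrix.of fun i j : Fin 1 => if i.val + j.val + 1 = 1 then (1 : L) else 0)).Local v) ⧸ Subgroup.centralizer ({γ} : Set ((cmDatum L 2 (Matrix.of fun i j : Fin 2 => if i.val + j.val + 1 = 2 then (1 : L) else 0)).Local v × (cmDatum L 1 (Matrix.of fun i j : Fin 1 => if i.val + j.val + 1 = 1 then (1 : L) else 0)).Local v)))]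
    [∀ γ : (cmDatum L 2 (Matrix.of fun i j : Fin 2 => if i.val + j.val + 1 = 2 then (1 : L) else 0)).Local v × (cmDatum L 1 (Matrix.of fun i j : Fin 1 => if i.val + j.val + 1 = 1 then (1 : L) else 0)).Local v, BorelSpace (((cmDatum L 2 (Matrix.of fun i j : Fin 2 => if i.val + j.val + 1 = 2 then (1 : L) else 0)).Local v × (cmDatum L 1 (Matrix.of fun i j : Fin 1 => if i.val + j.val + 1 = 1 then (1 : L) else 0)).Local v) ⧸ Subgroup.centralizer ({γ} : Set ((cmDatum L 2 (Matrix.of fun i j : Fin 2 => if i.val + j.val + 1 = 2 then (1 : L) else 0)).Local v × (cmDatum L 1 (Matrix.of fun i j : Fin 1 => if i.val + j.val + 1 = 1 then (1 : L) else 0)).Local v)))]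
    (z : (cmDatum L 2 (Matrix.of fun i j : Fin 2 => if i.val + j.val + 1 = 2 then (1 : L) else 0)).Local v × (cmDatum L 1 (Matrix.of fun i j : Fin 1 => if i.val + j.val + 1 = 1 then (1 : L) else 0)).Local v) (hz : z ∈ Subgroup.center ((cmDatum L 2 (Matrix.of fun i j : Fin 2 => if i.val + j.val + 1 = 2 then (1 : L) else 0)).Local v × (cmDatum L 1 (Matrix.of fun i j : Fin 1 => if i.val + j.val + 1 = 1 then (1 : L) else 0)).Local v))
    (u : (cmDatum L 2 (Matrix.of fun i j : Fin 2 => if i.val + j.val + 1 = 2 then (1 : L) else 0)).Local v) {t₀ : w.1.adicCompletion L} (ht₀ : t₀ ≠ 0)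
    (hu : (((localNonsplitEquiv (IsCMField.complexConj L) (Matrix.of fun i j : Fin 2 => if i.val + j.val + 1 = 2 then (1 : L) else 0) (IsCMField.complexConj_ne_one L) w hw u : ↥(unitaryGroupOfForm (galAdicCompletionMap (L := L) (IsCMField.complexConj L) hw) (placeForm (Matrix.of fun i j : Fin 2 => if i.val + j.val + 1 = 2 then (1 : L) else 0) w.1))) : GL (Fin 2) (w.1.adicCompletion L)) : Matrix (Fin 2) (Fin 2) (w.1.adicCompletion L)) = !![1, t₀; 0, 1])
    (μ : Measure (((cmDatum L 2 (Matrix.of fun i j : Fin 2 => if i.val + j.val + 1 = 2 then (1 : L) else 0)).Local v × (cmDatum L 1 (Matrix.of fun i j : Fin 1 => if i.val + j.val + 1 = 1 then (1 : L) else 0)).Local v) ⧸ Subgroup.centralizer ({(u, 1) * z} : Set ((cmDatum L 2 (Matrix.of fun i j : Fin 2 => if i.val + j.val + 1 = 2 then (1 : L) else 0)).Local v × (cmDatum L 1 (Matrix.of fun i j : Fin 1 => if i.val + j.val + 1 = 1 then (1 : L) else 0)).Local v))))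
    [SMulInvariantMeasure ((cmDatum L 2 (Matrix.of fun i j : Fin 2 => if i.val + j.val + 1 = 2 then (1 : L) else 0)).Local v × (cmDatum L 1 (Matrix.of fun i j : Fin 1 => if i.val + j.val + 1 = 1 then (1 : L) else 0)).Local v) _ μ] [IsFiniteMeasureOnCompacts μ]
    {C : Set ((cmDatum L 2 (Matrix.of fun i j : Fin 2 => if i.val + j.val + 1 = 2 then (1 : L) else 0)).Local v × (cmDatum L 1 (Matrix.of fun i j : Fin 1 => if i.val + j.val + 1 = 1 then (1 : L) else 0)).Local v)} (hC : IsCompact C) :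
    μ ((descConj ((u, 1) * z) (Subgroup.centralizer ({(u, 1) * z} : Set ((cmDatum L 2 (Matrix.of fun i j : Fin 2 => if i.val + j.val + 1 = 2 then (1 : L) else 0)).Local v × (cmDatum L 1 (Matrix.of fun i j : Fin 1 => if i.val + j.val + 1 = 1 then (1 : L) else 0)).Local v))) (fun _ hg => Subgroup.mem_centralizer_singleton_iff.1 hg) id) ⁻¹' C) < ⊤ := by
  classical
  -- ## 0. The dictionary `ψ` at `N = 2` (frame `T = 1`, ★ p855844) and the local field data
  obtain ⟨ψ, hψ⟩ : ∃ ψ : (cmDatum L 2 (Matrix.of fun i j : Fin 2 => if i.val + j.val + 1 = 2 then (1 : L) else 0)).Local v → GL (Fin 2) (w.1.adicCompletion L), ∀ y, ψ y = ((localNonsplitEquiv (IsCMField.complexConj L) (Matrix.of fun i j : Fin 2 => if i.val + j.val + 1 = 2 then (1 : L) else 0) (IsCMField.complexConj_ne_one L) w hw y : ↥(unitaryGroupOfForm (galAdicCompletionMap (L := L) (IsCMField.complexConj L) hw) (placeForm (Matrix.of fun i j : Fin 2 => if i.val + j.val + 1 = 2 then (1 : L) else 0) w.1))) : GL (Fin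 2) (w.1.adicCompletion L)) := ⟨_, fun _ => rfl⟩
  have hψU : ∀ y, ψ y ∈ unitaryGroupOfForm (galAdicCompletionMap (L := L) (IsCMField.complexConj L) hw) ((StdForm.antidiagonal 2).over (w.1.adicCompletion L)) := fun y => by
    rw [hψ]; exact coe_localNonsplitEquiv_two_mem L w hw y
  have hψmul : ∀ y y', ψ (y * y') = ψ y * ψ y' := fun y y' => by
    rw [hψ, hψ, hψ]; exact congrArg Subtype.val (map_mul (localNonsplitEquiv (IsCMField.complexConj L) _ (IsCMField.complexConj_ne_one L) w hw) y y')
  have hψinv : ∀ y, ψ y⁻¹ = (ψ y)⁻¹ := fun y => by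
    rw [hψ, hψ]; exact congrArg Subtype.val (map_inv (localNonsplitEquiv (IsCMField.complexConj L) _ (IsCMField.complexConj_ne_one L) w hw) y)
  have hψinj : ∀ y y', ψ y = ψ y' → y = y' := fun y y' h => by
    rw [hψ, hψ] at h; exact (localNonsplitEquiv (IsCMField.complexConj L) _ (IsCMField.complexConj_ne_one L) w hw).injective (Subtype.ext h)
  have hψsurj : ∀ g ∈ unitaryGroupOfForm (galAdicCompletionMap (L := L) (IsCMField.complexConj L) hw) ((StdForm.antidiagonal 2).over (w.1.adicCompletion L)), ∃ y, ψ y = g := by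
    intro g hg
    have hg' : g ∈ unitaryGroupOfForm (galAdicCompletionMap (L := L) (IsCMField.complexConj L) hw) (placeForm (Matrix.of fun i j : Fin 2 => if i.val + j.val + 1 = 2 then (1 : L) else 0) w.1) := by
      rw [placeForm_antidiagTwo_eq_over L w]; exact hg
    exact ⟨(localNonsplitEquiv (IsCMField.complexConj L) _ (IsCMField.complexConj_ne_one L) w hw).symm ⟨g, hg'⟩, by
      rw [hψ]; exact congrArg Subtype.val ((localNonsplitEquiv (IsCMField.complexConj L) _ (IsCMField.complexConj_ne_one L) w hw).apply_symm_apply ⟨g, hg'⟩)⟩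
  have hvσ : ∀ x : w.1.adicCompletion L, Valued.v (galAdicCompletionMap (L := L) (IsCMField.complexConj L) hw x) = Valued.v x := fun x => valued_galAdicCompletionMap (L := L) (IsCMField.complexConj L) hw x
  have hψK : ∀ y, y ∈ cmLocalIntegralLevel L 2 (Matrix.of fun i j : Fin 2 => if i.val + j.val + 1 = 2 then (1 : L) else 0) v ↔ IsIntMatrix ((ψ y : GL (Fin 2) (w.1.adicCompletion L)) : Matrix (Fin 2) (Fin 2) (w.1.adicCompletion L)) := by
    intro y
    rw [hψ]
    exact (mem_localIntegralLevel_iff_of_smul_eq (IsCMField.complexConj L) 2 (Matrix.of fun i j : Fin 2 => if i.val + j.val + 1 = 2 then (1 : L) else 0) (IsCMField.complexConj_ne_one L) w hw y).trans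
      (Two.mem_glInt_iff_forall_v_le_one (galAdicCompletionMap (L := L) (IsCMField.complexConj L) hw) (placeForm_antidiagTwo_eq_over L w) hvσ _)
  have hψcont : ∀ a b, Continuous fun y => ((ψ y : GL (Fin 2) (w.1.adicCompletion L)) : Matrix (Fin 2) (Fin 2) (w.1.adicCompletion L)) a b := fun a b => by
    simp only [hψ]
    exact (Units.continuous_val.comp (continuous_coe_localNonsplitEquiv_two L w hw)).matrix_elem a b
  have hψentry : ∀ (y : (cmDatum L 2 (Matrix.of fun i j : Fin 2 => if i.val + j.val + 1 = 2 then (1 : L) else 0)).Local v) (a b : Fin 2), ((ψ y : GL (Fin 2) (w.1.adicCompletion L)) : Matrix (Fin 2) (Fin 2) (w.1.adicCompletion L)) a b =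
      (((y.val : GL (Fin 2) (UnitaryGroup.LocalRing L v)) : Matrix (Fin 2) (Fin 2) (UnitaryGroup.LocalRing L v)) a b) w := by
    intro y a b
    rw [hψ, coe_coe_localNonsplitEquiv_apply]
    rfl
  have hψu : ((ψ u : GL (Fin 2) (w.1.adicCompletion L)) : Matrix (Fin 2) (Fin 2) (w.1.adicCompletion L)) = !![1, t₀; 0, 1] := by rw [hψ]; exact hu
  have hψone : ψ 1 = 1 := by
    rw [hψ]; exact congrArg Subtype.val (map_one (localNonsplitEquiv (IsCMField.complexConj L) _ (IsCMField.complexConj_ne_one L) w hw))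
  -- the local field data: `σ_w` an involution preserving the valuation, `t₀` skew, a uniformiser `ϖ`
  have hcc : IsCMField.complexConj L * IsCMField.complexConj L = 1 := AlgEquiv.ext fun y => IsCMField.complexConj_apply_apply L y
  have hσσ : ∀ x : w.1.adicCompletion L, galAdicCompletionMap (L := L) (IsCMField.complexConj L) hw (galAdicCompletionMap (L := L) (IsCMField.complexConj L) hw x) = x :=
    fun x => Literature.NumberTheory.Automorphic.Liu2021.galAdicCompletionMap_galAdicCompletionMap_self _ L (IsCMField.complexConj L) hcc hw x
  have hσt₀ : galAdicCompletionMap (L := L) (IsCMField.complexConj L) hw t₀ + t₀ = 0 := (mem_unitaryGroupOfForm_iff_of_coe_eq_lineUnipotent _ hψu).1 (hψU u)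
  obtain ⟨πL, hπL⟩ := w.1.valuation_exists_uniformizer L
  obtain ⟨ϖ, hϖdef⟩ : ∃ ϖ : w.1.adicCompletion L, ϖ = (πL : w.1.adicCompletion L) := ⟨_, rfl⟩
  have hvϖ : Valued.v ϖ = WithZero.exp (-1 : ℤ) := by rw [hϖdef, HeightOneSpectrum.valuedAdicCompletion_eq_valuation', hπL]
  have hϖ0 : ϖ ≠ 0 := fun h => by rw [h, map_zero] at hvϖ; exact WithZero.exp_ne_zero hvϖ.symm
  have hvϖle : Valued.v ϖ ≤ 1 := by rw [hvϖ, ← WithZero.exp_zero]; exact WithZero.exp_le_exp.2 (by norm_num)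
  have hvσϖle : Valued.v (galAdicCompletionMap (L := L) (IsCMField.complexConj L) hw ϖ) ≤ 1 := by rw [hvσ]; exact hvϖle
  have hσϖ0 : galAdicCompletionMap (L := L) (IsCMField.complexConj L) hw ϖ ≠ 0 := (map_ne_zero _).2 hϖ0
  -- the contracting element `a = (ψ⁻¹ d(ϖ), 1)`, `d(ϖ) = diag(ϖ, (σϖ)⁻¹)`
  obtain ⟨dϖ, hdϖ, hdϖ'⟩ := exists_units_coe_eq_torusEltTwo (galAdicCompletionMap (L := L) (IsCMField.complexConj L) hw) hϖ0
  have hdϖU := torusEltTwo_mem_unitaryGroupOfForm (galAdicCompletionMap (L := L) (IsCMField.complexConj L) hw) hϖ0 (hσσ ϖ) hdϖ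
  have hdϖ'' : ((dϖ⁻¹ : GL (Fin 2) (w.1.adicCompletion L)) : Matrix (Fin 2) (Fin 2) (w.1.adicCompletion L)) = Matrix.diagonal ![ϖ⁻¹, ((galAdicCompletionMap (L := L) (IsCMField.complexConj L) hw ϖ)⁻¹)⁻¹] := by rw [hdϖ', inv_inv]
  obtain ⟨a₂, ha₂⟩ := hψsurj dϖ hdϖU
  obtain ⟨a, ha⟩ : ∃ a : (cmDatum L 2 (Matrix.of fun i j : Fin 2 => if i.val + j.val + 1 = 2 then (1 : L) else 0)).Local v × (cmDatum L 1 (Matrix.of fun i j : Fin 1 => if i.val + j.val + 1 = 1 then (1 : L) else 0)).Local v, a = (a₂, 1) := ⟨_, rfl⟩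
  have haconj : ∀ y, ((ψ (a₂ * y * a₂⁻¹) : GL (Fin 2) (w.1.adicCompletion L)) : Matrix (Fin 2) (Fin 2) (w.1.adicCompletion L)) =
      (dϖ : Matrix (Fin 2) (Fin 2) (w.1.adicCompletion L)) * ((ψ y : GL (Fin 2) (w.1.adicCompletion L)) : Matrix (Fin 2) (Fin 2) (w.1.adicCompletion L)) * ((dϖ⁻¹ : GL (Fin 2) (w.1.adicCompletion L)) : Matrix (Fin 2) (Fin 2) (w.1.adicCompletion L)) := by
    intro y; rw [hψmul, hψmul, hψinv, ha₂, Units.val_mul, Units.val_mul]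
  have hafst : ∀ h : (cmDatum L 2 (Matrix.of fun i j : Fin 2 => if i.val + j.val + 1 = 2 then (1 : L) else 0)).Local v × (cmDatum L 1 (Matrix.of fun i j : Fin 1 => if i.val + j.val + 1 = 1 then (1 : L) else 0)).Local v, (a * h * a⁻¹).1 = a₂ * h.1 * a₂⁻¹ := fun h => by rw [ha]; rfl
  -- the centre: `z₁` commutes with everything in `G₂`
  have hzc : ∀ g : (cmDatum L 2 (Matrix.of fun i j : Fin 2 => if i.val + j.val + 1 = 2 then (1 : L) else 0)).Local v × (cmDatum L 1 (Matrix.of fun i j : Fin 1 => if i.val + j.val + 1 = 1 then (1 : L) else 0)).Local v, g * z = z * g := fun g => Subgroup.mem_center_iff.1 hz g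
  have hz1 : ∀ k : (cmDatum L 2 (Matrix.of fun i j : Fin 2 => if i.val + j.val + 1 = 2 then (1 : L) else 0)).Local v, k * z.1 = z.1 * k := fun k => (fst_comm_of_mem_center hz k).1
  -- the compact open `K = U(Φ₂)(𝒪_v) × U(Φ₁)(L⁺_v)`
  obtain ⟨K, hKdef⟩ : ∃ K : Subgroup ((cmDatum L 2 (Matrix.of fun i j : Fin 2 => if i.val + j.val + 1 = 2 then (1 : L) else 0)).Local v × (cmDatum L 1 (Matrix.of fun i j : Fin 1 => if i.val + j.val + 1 = 1 then (1 : L) else 0)).Local v), K = (cmLocalIntegralLevel L 2 (Matrix.of fun i j : Fin 2 => if i.val + j.val + 1 = 2 then (1 : L) else 0) v).prod ⊤ := ⟨_, rfl⟩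
  have hKmem : ∀ h : (cmDatum L 2 (Matrix.of fun i j : Fin 2 => if i.val + j.val + 1 = 2 then (1 : L) else 0)).Local v × (cmDatum L 1 (Matrix.of fun i j : Fin 1 => if i.val + j.val + 1 = 1 then (1 : L) else 0)).Local v, h ∈ K ↔ h.1 ∈ cmLocalIntegralLevel L 2 (Matrix.of fun i j : Fin 2 => if i.val + j.val + 1 = 2 then (1 : L) else 0) v := fun h => by
    rw [hKdef, Subgroup.mem_prod]
    exact ⟨fun hh => hh.1, fun hh => ⟨hh, Subgroup.mem_top _⟩⟩
  -- ## 1. The centraliser `Z((u,1)·z)` through `ψ`: the commutation criterion with `n(t₀)` on the first factor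
  have hcent : ∀ y : (cmDatum L 2 (Matrix.of fun i j : Fin 2 => if i.val + j.val + 1 = 2 then (1 : L) else 0)).Local v × (cmDatum L 1 (Matrix.of fun i j : Fin 1 => if i.val + j.val + 1 = 1 then (1 : L) else 0)).Local v, y ∈ Subgroup.centralizer ({(u, 1) * z} : Set ((cmDatum L 2 (Matrix.of fun i j : Fin 2 => if i.val + j.val + 1 = 2 then (1 : L) else 0)).Local v × (cmDatum L 1 (Matrix.of fun i j : Fin 1 => if i.val + j.val + 1 = 1 then (1 : L) else 0)).Local v)) ↔
      (((ψ y.1 : GL (Fin 2) (w.1.adicCompletion L)) : Matrix (Fin 2) (Fin 2) (w.1.adicCompletion L)) 1 0 = 0 ∧ ((ψ y.1 : GL (Fin 2) (w.1.adicCompletion L)) : Matrix (Fin 2) (Fin 2) (w.1.adicCompletion L)) 0 0 = ((ψ y.1 : GL (Fin 2) (w.1.adicCompletion L)) : Matrix (Fin 2) (Fin 2) (w.1.adicCompletion L)) 1 1) := by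
    intro y
    rw [Subgroup.mem_centralizer_singleton_iff]
    have e1 : (y * ((u, 1) * z) = (u, 1) * z * y) ↔ y * (u, 1) = (u, 1) * y := by
      rw [← mul_assoc, mul_assoc (u, (1 : (cmDatum L 1 (Matrix.of fun i j : Fin 1 => if i.val + j.val + 1 = 1 then (1 : L) else 0)).Local v)) z y, ← hzc y, ← mul_assoc]
      exact mul_right_cancel_iff
    rw [e1, Prod.ext_iff]
    simp only [Prod.fst_mul, Prod.snd_mul, mul_one, one_mul, and_true]
    rw [← mul_lineUnipotent_eq_lineUnipotent_mul_iff ht₀, ← hψu, ← Units.val_mul, ← Units.val_mul, ← hψmul, ← hψmul]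
    constructor
    · intro h; rw [h]
    · intro h; exact hψinj _ _ (Units.ext h)
  -- `a` normalises `Z((u,1)·z)`
  have hanorm : ∀ h : (cmDatum L 2 (Matrix.of fun i j : Fin 2 => if i.val + j.val + 1 = 2 then (1 : L) else 0)).Local v × (cmDatum L 1 (Matrix.of fun i j : Fin 1 => if i.val + j.val + 1 = 1 then (1 : L) else 0)).Local v, h ∈ Subgroup.centralizer ({(u, 1) * z} : Set ((cmDatum L 2 (Matrix.of fun i j : Fin 2 => if i.val + j.val + 1 = 2 then (1 : L) else 0)).Local v × (cmDatum L 1 (Matrix.of fun i j : Fin 1 => if i.val + j.val + 1 = 1 then (1 : L) else 0)).Local v)) ↔ a * h * a⁻¹ ∈ Subgroup.centralizer ({(u, 1) * z} : Set ((cmDatum L 2 (Matrix.of fun i j : Fin 2 => if i.val + j.val + 1 = 2 then (1 : L) else 0)).Local v × (cmDatum L 1 (Matrix.of fun i j : Fin 1 => if i.val + j.val + 1 = 1 then (1 : L) else 0)).Local v)) := by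
    intro h
    rw [hcent, hcent, hafst, haconj]
    exact lineCriterion_conj_diagonal_iff hdϖ hdϖ'' hϖ0 (inv_ne_zero hσϖ0) _
  -- `Ad(a)` improves `K`-integrality on `Z((u,1)·z)`
  have haK : ∀ h : (cmDatum L 2 (Matrix.of fun i j : Fin 2 => if i.val + j.val + 1 = 2 then (1 : L) else 0)).Local v × (cmDatum L 1 (Matrix.of fun i j : Fin 1 => if i.val + j.val + 1 = 1 then (1 : L) else 0)).Local v, h ∈ Subgroup.centralizer ({(u, 1) * z} : Set ((cmDatum L 2 (Matrix.of fun i j : Fin 2 => if i.val + j.val + 1 = 2 then (1 : L) else 0)).Local v × (cmDatum L 1 (Matrix.of fun i j : Fin 1 => if i.val + j.val + 1 = 1 then (1 : L) else 0)).Local v)) → h ∈ K → a * h * a⁻¹ ∈ K := by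
    intro h hh hK
    obtain ⟨h10, -⟩ := (hcent h).1 hh
    rw [hKmem] at hK ⊢
    rw [hafst, hψK, haconj]
    exact isIntMatrix_torusEltTwo_conj_of_apply_one_zero_eq_zero _ hϖ0 hvϖle hvσϖle hdϖ hdϖ' ((hψK h.1).1 hK) h10
  -- … STRICTLY: the witness `(ψ⁻¹ n(s), 1)`, `s = t₀ (ϖ σϖ)^k` skew with `1 < |s| ≤ |ϖ|⁻²`
  obtain ⟨nt, hnt⟩ : ∃ nt : ℤ, Valued.v t₀ = WithZero.exp nt := by
    have h0 : Valued.v t₀ ≠ 0 := (Valuation.ne_zero_iff _).2 ht₀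
    obtain ⟨x, hx⟩ := WithZero.ne_zero_iff_exists.1 h0
    exact ⟨Multiplicative.toAdd x, by rw [← hx]; rfl⟩
  obtain ⟨k, m, hm12, hkm⟩ : ∃ k m : ℤ, (m = 1 ∨ m = 2) ∧ nt = m + 2 * k :=
    ⟨(nt - 1) / 2, nt - 2 * ((nt - 1) / 2), by omega, by ring⟩
  obtain ⟨s, hsdef⟩ : ∃ s : w.1.adicCompletion L, s = t₀ * (ϖ * galAdicCompletionMap (L := L) (IsCMField.complexConj L) hw ϖ) ^ k := ⟨_, rfl⟩
  have hvN : Valued.v (ϖ * galAdicCompletionMap (L := L) (IsCMField.complexConj L) hw ϖ) = WithZero.exp (-2 : ℤ) := by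
    rw [map_mul, hvσ, hvϖ, ← WithZero.exp_add]; norm_num
  have hvs : Valued.v s = WithZero.exp m := by
    have e1 : Valued.v ((ϖ * galAdicCompletionMap (L := L) (IsCMField.complexConj L) hw ϖ) ^ k) = WithZero.exp (-2 * k) := by
      rw [map_zpow₀, hvN, ← WithZero.exp_zsmul, smul_eq_mul]; congr 1; ring
    rw [hsdef, map_mul, hnt, e1, ← WithZero.exp_add, hkm]; congr 1; ring
  have hσs : galAdicCompletionMap (L := L) (IsCMField.complexConj L) hw s + s = 0 := by
    have hσt : galAdicCompletionMap (L := L) (IsCMField.complexConj L) hw t₀ = -t₀ := eq_neg_of_add_eq_zero_left hσt₀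
    rw [hsdef, map_mul, map_zpow₀, map_mul, hσσ, hσt, mul_comm (galAdicCompletionMap (L := L) (IsCMField.complexConj L) hw ϖ) ϖ]
    ring
  have hvs_gt : ¬ Valued.v s ≤ 1 := by
    rw [hvs, ← WithZero.exp_zero, WithZero.exp_le_exp]; omega
  have hvNs : Valued.v (ϖ * galAdicCompletionMap (L := L) (IsCMField.complexConj L) hw ϖ * s) ≤ 1 := by
    rw [map_mul, hvN, hvs, ← WithZero.exp_add, ← WithZero.exp_zero, WithZero.exp_le_exp]; omega
  obtain ⟨ns, hns, -⟩ := exists_units_coe_eq_lineUnipotent s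
  have hnsU : ns ∈ unitaryGroupOfForm (galAdicCompletionMap (L := L) (IsCMField.complexConj L) hw) ((StdForm.antidiagonal 2).over (w.1.adicCompletion L)) := (mem_unitaryGroupOfForm_iff_of_coe_eq_lineUnipotent _ hns).2 hσs
  obtain ⟨ys₂, hys₂⟩ := hψsurj ns hnsU
  obtain ⟨ys, hysdef⟩ : ∃ ys : (cmDatum L 2 (Matrix.of fun i j : Fin 2 => if i.val + j.val + 1 = 2 then (1 : L) else 0)).Local v × (cmDatum L 1 (Matrix.of fun i j : Fin 1 => if i.val + j.val + 1 = 1 then (1 : L) else 0)).Local v, ys = (ys₂, 1) := ⟨_, rfl⟩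
  have hys1 : ys.1 = ys₂ := by rw [hysdef]
  have hstrict : ∃ h : (cmDatum L 2 (Matrix.of fun i j : Fin 2 => if i.val + j.val + 1 = 2 then (1 : L) else 0)).Local v × (cmDatum L 1 (Matrix.of fun i j : Fin 1 => if i.val + j.val + 1 = 1 then (1 : L) else 0)).Local v, h ∈ Subgroup.centralizer ({(u, 1) * z} : Set ((cmDatum L 2 (Matrix.of fun i j : Fin 2 => if i.val + j.val + 1 = 2 then (1 : L) else 0)).Local v × (cmDatum L 1 (Matrix.of fun i j : Fin 1 => if i.val + j.val + 1 = 1 then (1 : L) else 0)).Local v)) ∧ h ∉ K ∧ a * h * a⁻¹ ∈ K := by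
    refine ⟨ys, ?_, ?_, ?_⟩
    · rw [hcent, hys1, hys₂, hns]
      refine ⟨?_, ?_⟩ <;> simp
    · rw [hKmem, hys1, hψK, hys₂, hns]
      intro hint
      have h01 := hint 0 1
      have e01 : (!![(1 : w.1.adicCompletion L), s; 0, 1] : Matrix (Fin 2) (Fin 2) (w.1.adicCompletion L)) 0 1 = s := rfl
      rw [e01] at h01
      exact hvs_gt h01
    · rw [hKmem, hafst, hys1, hψK, haconj, hys₂, ← Units.val_mul, ← Units.val_mul,
        coe_torusEltTwo_conj_lineUnipotent (galAdicCompletionMap (L := L) (IsCMField.complexConj L) hw) hϖ0 hdϖ hdϖ' hns]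
      obtain ⟨nn, hnn, -⟩ := exists_units_coe_eq_lineUnipotent (ϖ * galAdicCompletionMap (L := L) (IsCMField.complexConj L) hw ϖ * s)
      rw [← hnn]
      exact isIntMatrix_lineUnipotent hvNs hnn
  -- ## 2. Haar measures: `ν` on `H_v` (right invariant: `H_v` is unimodular) and `ρ` on the closed subgroup `Z((u,1)·z)`
  haveI hHcl : IsClosed ((Subgroup.centralizer ({(u, 1) * z} : Set ((cmDatum L 2 (Matrix.of fun i j : Fin 2 => if i.val + j.val + 1 = 2 then (1 : L) else 0)).Local v × (cmDatum L 1 (Matrix.of fun i j : Fin 1 => if i.val + j.val + 1 = 1 then (1 : L) else 0)).Local v)) : Subgroup ((cmDatum L 2 (Matrix.of fun i j : Fin 2 => if i.val + j.val + 1 = 2 then (1 : L) else 0)).Local v × (cmDatum L 1 (Matrix.of fun i j : Fin 1 => if i.val + j.val + 1 = 1 then (1 : L) else 0)).Local v)) : Set ((cmDatum L 2 (Matrix.of fun i j : Fin 2 => if i.val + j.val + 1 = 2 then (1 : L) else 0)).Local v × (cmDatum L 1 (Matrix.of fun i j : Fin 1 => if i.val + j.val + 1 = 1 then (1 : L) else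 0)).Local v)) := isClosed_coe_centralizer_singleton _
  haveI : LocallyCompactSpace ↥(Subgroup.centralizer ({(u, 1) * z} : Set ((cmDatum L 2 (Matrix.of fun i j : Fin 2 => if i.val + j.val + 1 = 2 then (1 : L) else 0)).Local v × (cmDatum L 1 (Matrix.of fun i j : Fin 1 => if i.val + j.val + 1 = 1 then (1 : L) else 0)).Local v))) := hHcl.isClosedEmbedding_subtypeVal.locallyCompactSpace
  obtain ⟨ρ, hρ⟩ : ∃ ρ : Measure ↥(Subgroup.centralizer ({(u, 1) * z} : Set ((cmDatum L 2 (Matrix.of fun i j : Fin 2 => if i.val + j.val + 1 = 2 then (1 : L) else 0)).Local v × (cmDatum L 1 (Matrix.of fun i j : Fin 1 => if i.val + j.val + 1 = 1 then (1 : L) else 0)).Local v))), ρ = Measure.haar := ⟨_, rfl⟩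
  haveI : ρ.IsHaarMeasure := by rw [hρ]; infer_instance
  obtain ⟨ν, hν⟩ : ∃ ν : Measure ((cmDatum L 2 (Matrix.of fun i j : Fin 2 => if i.val + j.val + 1 = 2 then (1 : L) else 0)).Local v × (cmDatum L 1 (Matrix.of fun i j : Fin 1 => if i.val + j.val + 1 = 1 then (1 : L) else 0)).Local v), ν = Measure.haar := ⟨_, rfl⟩
  haveI : ν.IsHaarMeasure := by rw [hν]; infer_instance
  haveI : ν.IsMulRightInvariant := isMulRightInvariant_localEndoscopic L v ν
  -- ## 3. The covering of the orbit-preimage of `C` by level shells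
  obtain ⟨hKc₂, hKo₂⟩ := isCompact_isOpen_cmLocalIntegralLevel L 2 (Matrix.of fun i j : Fin 2 => if i.val + j.val + 1 = 2 then (1 : L) else 0) v
  haveI : CompactSpace ((cmDatum L 1 (Matrix.of fun i j : Fin 1 => if i.val + j.val + 1 = 1 then (1 : L) else 0)).Local v) := compactSpace_cmDatum_local_one_of_smul_eq L v w hw
  have hKo : IsOpen ((K : Subgroup ((cmDatum L 2 (Matrix.of fun i j : Fin 2 => if i.val + j.val + 1 = 2 then (1 : L) else 0)).Local v × (cmDatum L 1 (Matrix.of fun i j : Fin 1 => if i.val + j.val + 1 = 1 then (1 : L) else 0)).Local v)) : Set ((cmDatum L 2 (Matrix.of fun i j : Fin 2 => if i.val + j.val + 1 = 2 then (1 : L) else 0)).Local v × (cmDatum L 1 (Matrix.of fun i j : Fin 1 => if i.val + j.val + 1 = 1 then (1 : L) else 0)).Local v)) := by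
    rw [hKdef, Subgroup.coe_prod, Subgroup.coe_top]; exact hKo₂.prod isOpen_univ
  have hKc : IsCompact ((K : Subgroup ((cmDatum L 2 (Matrix.of fun i j : Fin 2 => if i.val + j.val + 1 = 2 then (1 : L) else 0)).Local v × (cmDatum L 1 (Matrix.of fun i j : Fin 1 => if i.val + j.val + 1 = 1 then (1 : L) else 0)).Local v)) : Set ((cmDatum L 2 (Matrix.of fun i j : Fin 2 => if i.val + j.val + 1 = 2 then (1 : L) else 0)).Local v × (cmDatum L 1 (Matrix.of fun i j : Fin 1 => if i.val + j.val + 1 = 1 then (1 : L) else 0)).Local v)) := by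
    rw [hKdef, Subgroup.coe_prod, Subgroup.coe_top]; exact hKc₂.prod isCompact_univ
  obtain ⟨C₂, hC₂def⟩ : ∃ C₂ : Set ((cmDatum L 2 (Matrix.of fun i j : Fin 2 => if i.val + j.val + 1 = 2 then (1 : L) else 0)).Local v), C₂ = (fun g : (cmDatum L 2 (Matrix.of fun i j : Fin 2 => if i.val + j.val + 1 = 2 then (1 : L) else 0)).Local v => g * z.1⁻¹) '' (Prod.fst '' C) := ⟨_, rfl⟩
  have hC₂ : IsCompact C₂ := by rw [hC₂def]; exact (hC.image continuous_fst).image (continuous_mul_const _)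
  have hC₁ : IsCompact ((cmLocalIntegralLevel L 2 (Matrix.of fun i j : Fin 2 => if i.val + j.val + 1 = 2 then (1 : L) else 0) v : Set ((cmDatum L 2 (Matrix.of fun i j : Fin 2 => if i.val + j.val + 1 = 2 then (1 : L) else 0)).Local v)) * C₂ * (cmLocalIntegralLevel L 2 (Matrix.of fun i j : Fin 2 => if i.val + j.val + 1 = 2 then (1 : L) else 0) v : Set ((cmDatum L 2 (Matrix.of fun i j : Fin 2 => if i.val + j.val + 1 = 2 then (1 : L) else 0)).Local v))) := (hKc₂.mul hC₂).mul hKc₂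
  have hball : ∀ mm : ℤ, IsOpen {x : w.1.adicCompletion L | Valued.v x ≤ WithZero.exp mm} := fun mm => (isClopen_setOf_valued_le L w.1 WithZero.exp_ne_zero).isOpen
  have hexp_of_ne : ∀ {x : w.1.adicCompletion L}, x ≠ 0 → ∃ n : ℤ, Valued.v x = WithZero.exp n := fun {x} hx => by
    have h0 : Valued.v x ≠ 0 := (Valuation.ne_zero_iff _).2 hx
    obtain ⟨e, he⟩ := WithZero.ne_zero_iff_exists.1 h0
    exact ⟨Multiplicative.toAdd e, by rw [← he]; rfl⟩
  obtain ⟨Mb, hMb⟩ : ∃ Mb : ℤ, ∀ g ∈ ((cmLocalIntegralLevel L 2 (Matrix.of fun i j : Fin 2 => if i.val + j.val + 1 = 2 then (1 : L) else 0) v : Set ((cmDatum L 2 (Matrix.of fun i j : Fin 2 => if i.val + j.val + 1 = 2 then (1 : L) else 0)).Local v)) * C₂ * (cmLocalIntegralLevel L 2 (Matrix.of fun i j : Fin 2 => if i.val + j.val + 1 = 2 then (1 : L) else 0) v : Set ((cmDatum L 2 (Matrix.of fun i j : Fin 2 => if i.val + j.val + 1 = 2 then (1 : L) else 0)).Lo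cal v))),
      Valued.v (((ψ g : GL (Fin 2) (w.1.adicCompletion L)) : Matrix (Fin 2) (Fin 2) (w.1.adicCompletion L)) 0 1) ≤ WithZero.exp Mb := by
    obtain ⟨U, hU⟩ : ∃ U : ℕ → Set ((cmDatum L 2 (Matrix.of fun i j : Fin 2 => if i.val + j.val + 1 = 2 then (1 : L) else 0)).Local v), ∀ mm, U mm = (fun y => ((ψ y : GL (Fin 2) (w.1.adicCompletion L)) : Matrix (Fin 2) (Fin 2) (w.1.adicCompletion L)) 0 1) ⁻¹'
        {x : w.1.adicCompletion L | Valued.v x ≤ WithZero.exp (mm : ℤ)} := ⟨_, fun _ => rfl⟩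
    have hUo : ∀ mm, IsOpen (U mm) := fun mm => by rw [hU]; exact (hball mm).preimage (hψcont 0 1)
    have hcov : ((cmLocalIntegralLevel L 2 (Matrix.of fun i j : Fin 2 => if i.val + j.val + 1 = 2 then (1 : L) else 0) v : Set ((cmDatum L 2 (Matrix.of fun i j : Fin 2 => if i.val + j.val + 1 = 2 then (1 : L) else 0)).Local v)) * C₂ * (cmLocalIntegralLevel L 2 (Matrix.of fun i j : Fin 2 => if i.val + j.val + 1 = 2 then (1 : L) else 0) v : Set ((cmDatum L 2 (Matrix.of fun i j : Fin 2 => if i.val + j.val + 1 = 2 then (1 : L) else 0)).Local v))) ⊆ ⋃ mm, U mm := by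
      intro g _
      rcases eq_or_ne (((ψ g : GL (Fin 2) (w.1.adicCompletion L)) : Matrix (Fin 2) (Fin 2) (w.1.adicCompletion L)) 0 1) 0 with h0 | h0
      · exact Set.mem_iUnion.2 ⟨0, by rw [hU]; simp [h0]⟩
      · obtain ⟨n, hn⟩ := hexp_of_ne h0
        refine Set.mem_iUnion.2 ⟨n.toNat, ?_⟩
        rw [hU, Set.mem_preimage, Set.mem_setOf_eq, hn]
        exact WithZero.exp_le_exp.2 (Int.self_le_toNat n)
    obtain ⟨t, ht⟩ := hC₁.elim_finite_subcover U hUo hcov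
    refine ⟨((t.sup id : ℕ) : ℤ), fun g hg => ?_⟩
    obtain ⟨mm, hmm, hgm⟩ := Set.mem_iUnion₂.1 (ht hg)
    rw [hU] at hgm
    exact (le_of_eq_of_le rfl hgm).trans (WithZero.exp_le_exp.2 (by exact_mod_cast Finset.le_sup (f := id) hmm))
  -- the auxiliary shells `g_n`, `ψ g_n = d(ϖ⁻¹ ^ n)`, for the finitely many positive levels
  have hzpow : ∀ n : ℕ, (ϖ⁻¹) ^ n ≠ 0 := fun n => pow_ne_zero _ (inv_ne_zero hϖ0)
  have hgn : ∀ n : ℕ, ∃ (dz : GL (Fin 2) (w.1.adicCompletion L)) (y : (cmDatum L 2 (Matrix.of fun i j : Fin 2 => if i.val + j.val + 1 = 2 then (1 : L) else 0)).Local v), (dz : Matrix (Fin 2) (Fin 2) (w.1.adicCompletion L)) = Matrix.diagonal ![(ϖ⁻¹) ^ n, (galAdicCompletionMap (L := L) (IsCMField.complexConj L) hw ((ϖ⁻¹) ^ n))⁻¹] ∧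
      ((dz⁻¹ : GL (Fin 2) (w.1.adicCompletion L)) : Matrix (Fin 2) (Fin 2) (w.1.adicCompletion L)) = Matrix.diagonal ![((ϖ⁻¹) ^ n)⁻¹, galAdicCompletionMap (L := L) (IsCMField.complexConj L) hw ((ϖ⁻¹) ^ n)] ∧ ψ y = dz := by
    intro n
    obtain ⟨dz, hdz, hdz'⟩ := exists_units_coe_eq_torusEltTwo (galAdicCompletionMap (L := L) (IsCMField.complexConj L) hw) (hzpow n)
    obtain ⟨y, hy⟩ := hψsurj dz (torusEltTwo_mem_unitaryGroupOfForm (galAdicCompletionMap (L := L) (IsCMField.complexConj L) hw) (hzpow n) (hσσ _) hdz)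
    exact ⟨dz, y, hdz, hdz', hy⟩
  choose dz g hdz hdz' hg using hgn
  -- `ψ (a₂ ^ m) = diag(ϖ^m, (σϖ)⁻¹^m)` and `a ^ m = (a₂ ^ m, 1)`
  have hapow : ∀ mm : ℕ, ((ψ (a₂ ^ mm) : GL (Fin 2) (w.1.adicCompletion L)) : Matrix (Fin 2) (Fin 2) (w.1.adicCompletion L)) = Matrix.diagonal ![ϖ ^ mm, ((galAdicCompletionMap (L := L) (IsCMField.complexConj L) hw ϖ)⁻¹) ^ mm] := by
    intro mm
    induction mm with
    | zero =>
      rw [pow_zero, hψone, Units.val_one, pow_zero, pow_zero]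
      ext i j; fin_cases i <;> fin_cases j <;> simp [Matrix.diagonal]
    | succ n ih =>
      rw [pow_succ, hψmul, Units.val_mul, ih, ha₂, hdϖ, Matrix.diagonal_mul_diagonal]
      congr 1; funext i; fin_cases i <;> simp [pow_succ]
  have hapow' : ∀ mm : ℕ, a ^ mm = (a₂ ^ mm, 1) := fun mm => by rw [ha, Prod.pow_mk, one_pow]
  -- the covering
  have hcover : (descConj ((u, 1) * z) (Subgroup.centralizer ({(u, 1) * z} : Set ((cmDatum L 2 (Matrix.of fun i j : Fin 2 => if i.val + j.val + 1 = 2 then (1 : L) else 0)).Local v × (cmDatum L 1 (Matrix.of fun i j : Fin 1 => if i.val + j.val + 1 = 1 then (1 : L) else 0)).Local v))) (fun _ hg => Subgroup.mem_centralizer_singleton_iff.1 hg) id) ⁻¹' C ⊆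
      (⋃ mm : ℕ, (QuotientGroup.mk : (cmDatum L 2 (Matrix.of fun i j : Fin 2 => if i.val + j.val + 1 = 2 then (1 : L) else 0)).Local v × (cmDatum L 1 (Matrix.of fun i j : Fin 1 => if i.val + j.val + 1 = 1 then (1 : L) else 0)).Local v → ((cmDatum L 2 (Matrix.of fun i j : Fin 2 => if i.val + j.val + 1 = 2 then (1 : L) else 0)).Local v × (cmDatum L 1 (Matrix.of fun i j : Fin 1 => if i.val + j.val + 1 = 1 then (1 : L) else 0)).Local v) ⧸ Subgroup.centralizer ({(u, 1) * z} : Set ((cmDatum L 2 (Matrix.of fun i j : Fin 2 => if i.val + j.val + 1 = 2 then (1 : L) else 0)).Local v × (cmDatum L 1 (Matrix.of fun i j : Fin 1 => if i.val + j.val + 1 = 1 then (1 : L) else 0)).Local v))) '' ((K : Set ((cmDatum L 2 (Matrix.of fun i j : Fin 2 => if i.val + j.val + 1 = 2 then (1 : L) else 0)).Local v × (cmDatum L 1 (Matrix.of fun i j : Fin 1 => if i.val + j.val + 1 = 1 then (1 : L) else 0)).Local v)) * {a ^ mm})) ∪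
        ⋃ n ∈ Finset.Icc 1 (Mb - nt).toNat,
          (QuotientGroup.mk : (cmDatum L 2 (Matrix.of fun i j : Fin 2 => if i.val + j.val + 1 = 2 then (1 : L) else 0)).Local v × (cmDatum L 1 (Matrix.of fun i j : Fin 1 => if i.val + j.val + 1 = 1 then (1 : L) else 0)).Local v → ((cmDatum L 2 (Matrix.of fun i j : Fin 2 => if i.val + j.val + 1 = 2 then (1 : L) else 0)).Local v × (cmDatum L 1 (Matrix.of fun i j : Fin 1 => if i.val + j.val + 1 = 1 then (1 : L) else 0)).Local v) ⧸ Subgroup.centralizer ({(u, 1) * z} : Set ((cmDatum L 2 (Matrix.of fun i j : Fin 2 => if i.val + j.val + 1 = 2 then (1 : L) else 0)).Local v × (cmDatum L 1 (Matrix.of fun i j : Fin 1 => if i.val + j.val + 1 = 1 then (1 : L) else 0)).Local v))) '' ((K : Set ((cmDatum L 2 (Matrix.of fun i j : Fin 2 => if i.val + j.val + 1 = 2 then (1 : L) else 0)).Local v × (cmDatum L 1 (Matrix.of fun i j : Fin 1 => if i.val + j.val + 1 = 1 then (1 : L) else 0)).Local v)) * {((g n, 1) : (cmDatum L 2 (Matrix.of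 fun i j : Fin 2 => if i.val + j.val + 1 = 2 then (1 : L) else 0)).Local v × (cmDatum L 1 (Matrix.of fun i j : Fin 1 => if i.val + j.val + 1 = 1 then (1 : L) else 0)).Local v)}) := by
    intro x hx
    obtain ⟨y, rfl⟩ := QuotientGroup.mk_surjective x
    rw [Set.mem_preimage, descConj_mk] at hx
    change y * ((u, 1) * z) * y⁻¹ ∈ C at hx
    -- the first component `y₁ u y₁⁻¹ ∈ C₂`
    have hx1 : y.1 * u * y.1⁻¹ ∈ C₂ := by
      rw [hC₂def]
      refine ⟨(y * ((u, 1) * z) * y⁻¹).1, Set.mem_image_of_mem _ hx, ?_⟩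
      show y.1 * (u * z.1) * y.1⁻¹ * z.1⁻¹ = y.1 * u * y.1⁻¹
      rw [show y.1 * (u * z.1) * y.1⁻¹ * z.1⁻¹ = y.1 * u * (z.1 * y.1⁻¹) * z.1⁻¹ by group, ← hz1 y.1⁻¹]
      group
    -- Iwasawa `y₁ = κ b`
    obtain ⟨κ₁, hκK₁, b₁, hyb₁⟩ := exists_mem_cmLocalIntegralLevel_mul_borel L 2 v y.1
    have hbB := (mem_borelU_iff _).1 b₁.2
    obtain ⟨κ, hκ⟩ : ∃ κ : (cmDatum L 2 (Matrix.of fun i j : Fin 2 => if i.val + j.val + 1 = 2 then (1 : L) else 0)).Local v, κ = κ₁ := ⟨_, rfl⟩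
    obtain ⟨b, hb⟩ : ∃ b : (cmDatum L 2 (Matrix.of fun i j : Fin 2 => if i.val + j.val + 1 = 2 then (1 : L) else 0)).Local v, b = (b₁ : ↥(unitaryGroupOfForm (conjLocal L (IsCMField.complexConj L) v) (cmLocalForm L 2 v))) := ⟨_, rfl⟩
    have hκK : κ ∈ cmLocalIntegralLevel L 2 (Matrix.of fun i j : Fin 2 => if i.val + j.val + 1 = 2 then (1 : L) else 0) v := by rw [hκ]; exact hκK₁
    have hyb : y.1 = κ * b := by rw [hκ, hb]; exact hyb₁
    have hb10 : ((ψ b : GL (Fin 2) (w.1.adicCompletion L)) : Matrix (Fin 2) (Fin 2) (w.1.adicCompletion L)) 1 0 = 0 := by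
      rw [hψentry, hb]; exact (congrFun (hbB (show id (0 : Fin 2) < id (1 : Fin 2) by decide)) w).trans rfl
    have hrel := diag_rel_of_upper_mem_unitaryGroupOfForm_two (galAdicCompletionMap (L := L) (IsCMField.complexConj L) hw) (hψU b) hb10
    have h00ne : ((ψ b : GL (Fin 2) (w.1.adicCompletion L)) : Matrix (Fin 2) (Fin 2) (w.1.adicCompletion L)) 0 0 ≠ 0 := fun h => by
      rw [h, map_zero, zero_mul] at hrel; exact zero_ne_one hrel
    have h11ne : ((ψ b : GL (Fin 2) (w.1.adicCompletion L)) : Matrix (Fin 2) (Fin 2) (w.1.adicCompletion L)) 1 1 ≠ 0 := fun h => by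
      rw [h, mul_zero] at hrel; exact zero_ne_one hrel
    obtain ⟨n₀, hn₀⟩ := hexp_of_ne h00ne
    have hv11 : Valued.v (((ψ b : GL (Fin 2) (w.1.adicCompletion L)) : Matrix (Fin 2) (Fin 2) (w.1.adicCompletion L)) 1 1) = WithZero.exp (-n₀) := by
      have h := congrArg Valued.v hrel
      rw [map_mul, hvσ, map_one, hn₀] at h
      rw [WithZero.exp_neg, ← mul_eq_one_iff_eq_inv₀ WithZero.exp_ne_zero, mul_comm]
      exact h
    -- `ψ(b u b⁻¹) = n(t₀ b₀₀ σb₀₀)` lies in `ψ(K₂ C₂ K₂)`: the level `n₀` is bounded above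
    have hbub : ((ψ (b * u * b⁻¹) : GL (Fin 2) (w.1.adicCompletion L)) : Matrix (Fin 2) (Fin 2) (w.1.adicCompletion L)) =
        !![1, t₀ * ((ψ b : GL (Fin 2) (w.1.adicCompletion L)) : Matrix (Fin 2) (Fin 2) (w.1.adicCompletion L)) 0 0 * galAdicCompletionMap (L := L) (IsCMField.complexConj L) hw (((ψ b : GL (Fin 2) (w.1.adicCompletion L)) : Matrix (Fin 2) (Fin 2) (w.1.adicCompletion L)) 0 0); 0, 1] := by
      rw [hψmul, hψmul, hψinv]
      exact coe_conj_lineUnipotent_of_apply_one_zero_eq_zero (galAdicCompletionMap (L := L) (IsCMField.complexConj L) hw) hψu (hψU b) hb10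
    have hmemC₁ : b * u * b⁻¹ ∈ ((cmLocalIntegralLevel L 2 (Matrix.of fun i j : Fin 2 => if i.val + j.val + 1 = 2 then (1 : L) else 0) v : Set ((cmDatum L 2 (Matrix.of fun i j : Fin 2 => if i.val + j.val + 1 = 2 then (1 : L) else 0)).Local v)) * C₂ * (cmLocalIntegralLevel L 2 (Matrix.of fun i j : Fin 2 => if i.val + j.val + 1 = 2 then (1 : L) else 0) v : Set ((cmDatum L 2 (Matrix.of fun i j : Fin 2 => if i.val + j.val + 1 = 2 then (1 : L) else 0)).Local v))) := by
      have e : b * u * b⁻¹ = κ⁻¹ * (y.1 * u * y.1⁻¹) * κ := by rw [hyb]; group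
      rw [e]
      exact Set.mul_mem_mul (Set.mul_mem_mul ((cmLocalIntegralLevel L 2 (Matrix.of fun i j : Fin 2 => if i.val + j.val + 1 = 2 then (1 : L) else 0) v).inv_mem hκK) hx1) hκK
    have hlev : nt + n₀ + n₀ ≤ Mb := by
      have h := hMb _ hmemC₁
      rw [hbub] at h
      have e01 : (!![(1 : w.1.adicCompletion L), t₀ * ((ψ b : GL (Fin 2) (w.1.adicCompletion L)) : Matrix (Fin 2) (Fin 2) (w.1.adicCompletion L)) 0 0 * galAdicCompletionMap (L := L) (IsCMField.complexConj L) hw (((ψ b : GL (Fin 2) (w.1.adicCompletion L)) : Matrix (Fin 2) (Fin 2) (w.1.adicCompletion L)) 0 0); 0, 1] : Matrix (Fin 2) (Fin 2) (w.1.adicCompletion L)) 0 1 =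
          t₀ * ((ψ b : GL (Fin 2) (w.1.adicCompletion L)) : Matrix (Fin 2) (Fin 2) (w.1.adicCompletion L)) 0 0 * galAdicCompletionMap (L := L) (IsCMField.complexConj L) hw (((ψ b : GL (Fin 2) (w.1.adicCompletion L)) : Matrix (Fin 2) (Fin 2) (w.1.adicCompletion L)) 0 0) := rfl
      rw [e01, map_mul, map_mul, hvσ, hnt, hn₀, ← WithZero.exp_add, ← WithZero.exp_add, WithZero.exp_le_exp] at h
      exact h
    -- the diagonal part `d`, `ψ d = diag(b₀₀, b₁₁)`, and `n′ = d⁻¹ b ∈ Z(u)`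
    obtain ⟨dD, hdD, hdD'⟩ := exists_units_coe_eq_diagonal₂ h00ne h11ne
    have hdDU : dD ∈ unitaryGroupOfForm (galAdicCompletionMap (L := L) (IsCMField.complexConj L) hw) ((StdForm.antidiagonal 2).over (w.1.adicCompletion L)) := by
      refine (diagonal_mem_unitaryGroupOfForm_two_iff (galAdicCompletionMap (L := L) (IsCMField.complexConj L) hw) hdD).2 ⟨hrel, ?_⟩
      have h := congrArg (galAdicCompletionMap (L := L) (IsCMField.complexConj L) hw) hrel
      rw [map_mul, hσσ, map_one] at h
      rw [mul_comm]; exact h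
    obtain ⟨d, hd⟩ := hψsurj dD hdDU
    have hn' : (((ψ (d⁻¹ * b) : GL (Fin 2) (w.1.adicCompletion L)) : Matrix (Fin 2) (Fin 2) (w.1.adicCompletion L)) 1 0 = 0 ∧ ((ψ (d⁻¹ * b) : GL (Fin 2) (w.1.adicCompletion L)) : Matrix (Fin 2) (Fin 2) (w.1.adicCompletion L)) 0 0 = ((ψ (d⁻¹ * b) : GL (Fin 2) (w.1.adicCompletion L)) : Matrix (Fin 2) (Fin 2) (w.1.adicCompletion L)) 1 1) := by
      rw [hψmul, hψinv, hd, Units.val_mul, hdD']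
      refine ⟨?_, ?_⟩ <;>
        simp [Matrix.mul_apply, Matrix.diagonal, hb10, inv_mul_cancel₀ h00ne, inv_mul_cancel₀ h11ne]
    -- common tail: a shell element `(gg, 1)` with `ψ gg = d(zz)`, `|zz| = |b₀₀|`, carries `y Z`
    have key : ∀ (gg : (cmDatum L 2 (Matrix.of fun i j : Fin 2 => if i.val + j.val + 1 = 2 then (1 : L) else 0)).Local v) (zz : w.1.adicCompletion L) (dzz : GL (Fin 2) (w.1.adicCompletion L)), zz ≠ 0 →
        (dzz : Matrix (Fin 2) (Fin 2) (w.1.adicCompletion L)) = Matrix.diagonal ![zz, (galAdicCompletionMap (L := L) (IsCMField.complexConj L) hw zz)⁻¹] →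
        ((dzz⁻¹ : GL (Fin 2) (w.1.adicCompletion L)) : Matrix (Fin 2) (Fin 2) (w.1.adicCompletion L)) = Matrix.diagonal ![zz⁻¹, galAdicCompletionMap (L := L) (IsCMField.complexConj L) hw zz] →
        ψ gg = dzz → Valued.v zz = WithZero.exp n₀ →
        (QuotientGroup.mk y : ((cmDatum L 2 (Matrix.of fun i j : Fin 2 => if i.val + j.val + 1 = 2 then (1 : L) else 0)).Local v × (cmDatum L 1 (Matrix.of fun i j : Fin 1 => if i.val + j.val + 1 = 1 then (1 : L) else 0)).Local v) ⧸ Subgroup.centralizer ({(u, 1) * z} : Set ((cmDatum L 2 (Matrix.of fun i j : Fin 2 => if i.val + j.val + 1 = 2 then (1 : L) else 0)).Local v × (cmDatum L 1 (Matrix.of fun i j : Fin 1 => if i.val + j.val + 1 = 1 then (1 : L) else 0)).Local v))) ∈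
          (QuotientGroup.mk : (cmDatum L 2 (Matrix.of fun i j : Fin 2 => if i.val + j.val + 1 = 2 then (1 : L) else 0)).Local v × (cmDatum L 1 (Matrix.of fun i j : Fin 1 => if i.val + j.val + 1 = 1 then (1 : L) else 0)).Local v → ((cmDatum L 2 (Matrix.of fun i j : Fin 2 => if i.val + j.val + 1 = 2 then (1 : L) else 0)).Local v × (cmDatum L 1 (Matrix.of fun i j : Fin 1 => if i.val + j.val + 1 = 1 then (1 : L) else 0)).Local v) ⧸ Subgroup.centralizer ({(u, 1) * z} : Set ((cmDatum L 2 (Matrix.of fun i j : Fin 2 => if i.val + j.val + 1 = 2 then (1 : L) else 0)).Local v × (cmDatum L 1 (Matrix.of fun i j : Fin 1 => if i.val + j.val + 1 = 1 then (1 : L) else 0)).Local v))) '' ((K : Set ((cmDatum L 2 (Matrix.of fun i j : Fin 2 => if i.val + j.val + 1 = 2 then (1 : L) else 0)).Local v × (cmDatum L 1 (Matrix.of fun i j : Fin 1 => if i.val + j.val + 1 = 1 then (1 : L) else 0)).Local v)) * {((gg, 1) : (cmDatum L 2 (Matrix.of fun i j : Fin 2 => if i.val + j.val + 1 = 2 then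 (1 : L) else 0)).Local v × (cmDatum L 1 (Matrix.of fun i j : Fin 1 => if i.val + j.val + 1 = 1 then (1 : L) else 0)).Local v)}) := by
      intro gg zz dzz hzz hdzz hdzz' hgg hvz
      have hd₀K : d * gg⁻¹ ∈ cmLocalIntegralLevel L 2 (Matrix.of fun i j : Fin 2 => if i.val + j.val + 1 = 2 then (1 : L) else 0) v := by
        rw [hψK, hψmul, hψinv, hd, hgg, Units.val_mul, hdD, hdzz', Matrix.diagonal_mul_diagonal]
        intro i j
        fin_cases i <;> fin_cases j
        · show Valued.v (Matrix.diagonal (fun i => (![_, _] : Fin 2 → w.1.adicCompletion L) i * (![_, _] : Fin 2 → w.1.adicCompletion L) i) 0 0) ≤ 1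
          rw [Matrix.diagonal_apply_eq]
          simp only [Matrix.cons_val_zero]
          rw [map_mul, map_inv₀, hn₀, hvz, mul_inv_cancel₀ WithZero.exp_ne_zero]
        · show Valued.v (Matrix.diagonal (fun i => (![_, _] : Fin 2 → w.1.adicCompletion L) i * (![_, _] : Fin 2 → w.1.adicCompletion L) i) 0 1) ≤ 1
          rw [Matrix.diagonal_apply_ne _ (by decide)]; simp
        · show Valued.v (Matrix.diagonal (fun i => (![_, _] : Fin 2 → w.1.adicCompletion L) i * (![_, _] : Fin 2 → w.1.adicCompletion L) i) 1 0) ≤ 1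
          rw [Matrix.diagonal_apply_ne _ (by decide)]; simp
        · show Valued.v (Matrix.diagonal (fun i => (![_, _] : Fin 2 → w.1.adicCompletion L) i * (![_, _] : Fin 2 → w.1.adicCompletion L) i) 1 1) ≤ 1
          rw [Matrix.diagonal_apply_eq]
          simp only [Matrix.cons_val_one, Matrix.cons_val_fin_one]
          rw [map_mul, hvσ, hv11, hvz, ← WithZero.exp_add, neg_add_cancel, WithZero.exp_zero]
      refine ⟨((κ * (d * gg⁻¹), y.2) : (cmDatum L 2 (Matrix.of fun i j : Fin 2 => if i.val + j.val + 1 = 2 then (1 : L) else 0)).Local v × (cmDatum L 1 (Matrix.of fun i j : Fin 1 => if i.val + j.val + 1 = 1 then (1 : L) else 0)).Local v) * (gg, 1), Set.mul_mem_mul ?_ (Set.mem_singleton _), ?_⟩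
      · exact (hKmem _).2 ((cmLocalIntegralLevel L 2 (Matrix.of fun i j : Fin 2 => if i.val + j.val + 1 = 2 then (1 : L) else 0) v).mul_mem hκK hd₀K)
      rw [QuotientGroup.eq, hcent]
      have e : ((((κ * (d * gg⁻¹), y.2) : (cmDatum L 2 (Matrix.of fun i j : Fin 2 => if i.val + j.val + 1 = 2 then (1 : L) else 0)).Local v × (cmDatum L 1 (Matrix.of fun i j : Fin 1 => if i.val + j.val + 1 = 1 then (1 : L) else 0)).Local v) * (gg, 1))⁻¹ * y).1 = d⁻¹ * b := by
        show (κ * (d * gg⁻¹) * gg)⁻¹ * y.1 = d⁻¹ * b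
        rw [hyb]; group
      rw [e]; exact hn'
    rcases le_or_gt n₀ 0 with hle | hgt
    · refine Or.inl (Set.mem_iUnion.2 ⟨(-n₀).toNat, ?_⟩)
      obtain ⟨dzm, hdzm, hdzm'⟩ := exists_units_coe_eq_torusEltTwo (galAdicCompletionMap (L := L) (IsCMField.complexConj L) hw) (pow_ne_zero (-n₀).toNat hϖ0)
      have hψam : ψ (a₂ ^ (-n₀).toNat) = dzm := Units.ext (by rw [hapow, hdzm, map_pow, inv_pow])
      have hvz : Valued.v (ϖ ^ (-n₀).toNat) = WithZero.exp n₀ := by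
        rw [map_pow, hvϖ, ← zpow_natCast, ← WithZero.exp_zsmul, smul_eq_mul, Int.toNat_of_nonneg (by omega)]; congr 1; ring
      rw [hapow']
      exact key _ _ _ (pow_ne_zero _ hϖ0) hdzm hdzm' hψam hvz
    · refine Or.inr (Set.mem_iUnion₂.2 ⟨n₀.toNat, Finset.mem_Icc.2 ⟨by omega, by omega⟩, ?_⟩)
      have hvz : Valued.v (ϖ⁻¹ ^ n₀.toNat) = WithZero.exp n₀ := by
        rw [map_pow, map_inv₀, hvϖ, ← WithZero.exp_neg, neg_neg, ← zpow_natCast, ← WithZero.exp_zsmul, smul_eq_mul, mul_one,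
          Int.toNat_of_nonneg hgt.le]
      exact key _ _ _ (hzpow _) (hdz _) (hdz' _) (hg _) hvz
  -- ## 4. The measure bound (★ `InvariantQuotientAdaptedUnfoldingBound`)
  have hA : μ (⋃ mm : ℕ, (QuotientGroup.mk : (cmDatum L 2 (Matrix.of fun i j : Fin 2 => if i.val + j.val + 1 = 2 then (1 : L) else 0)).Local v × (cmDatum L 1 (Matrix.of fun i j : Fin 1 => if i.val + j.val + 1 = 1 then (1 : L) else 0)).Local v → ((cmDatum L 2 (Matrix.of fun i j : Fin 2 => if i.val + j.val + 1 = 2 then (1 : L) else 0)).Local v × (cmDatum L 1 (Matrix.of fun i j : Fin 1 => if i.val + j.val + 1 = 1 then (1 : L) else 0)).Local v) ⧸ Subgroup.centralizer ({(u, 1) * z} : Set ((cmDatum L 2 (Matrix.of fun i j : Fin 2 => if i.val + j.val + 1 = 2 then (1 : L) else 0)).Local v × (cmDatum L 1 (Matrix.of fun i j : Fin 1 => if i.val + j.val + 1 = 1 then (1 : L) else 0)).Local v))) '' ((K : Set ((cmDatum L 2 (Matrix.of fun i j : Fin 2 => if i.val + j.val + 1 = 2 then (1 : L) else 0)).Local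 v × (cmDatum L 1 (Matrix.of fun i j : Fin 1 => if i.val + j.val + 1 = 1 then (1 : L) else 0)).Local v)) * {a ^ mm})) < ⊤ := by
    have h := measure_iUnion_image_mk_mul_zpow_lt_top (Subgroup.centralizer ({(u, 1) * z} : Set ((cmDatum L 2 (Matrix.of fun i j : Fin 2 => if i.val + j.val + 1 = 2 then (1 : L) else 0)).Local v × (cmDatum L 1 (Matrix.of fun i j : Fin 1 => if i.val + j.val + 1 = 1 then (1 : L) else 0)).Local v))) ρ μ ν K hKo hKc a hanorm haK hstrict 0
    refine lt_of_le_of_lt (measure_mono fun x hx => ?_) h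
    obtain ⟨mm, hmm⟩ := Set.mem_iUnion.1 hx
    exact Set.mem_iUnion₂.2 ⟨(mm : ℤ), by simp, by rwa [zpow_natCast]⟩
  have hB : μ (⋃ n ∈ Finset.Icc 1 (Mb - nt).toNat,
      (QuotientGroup.mk : (cmDatum L 2 (Matrix.of fun i j : Fin 2 => if i.val + j.val + 1 = 2 then (1 : L) else 0)).Local v × (cmDatum L 1 (Matrix.of fun i j : Fin 1 => if i.val + j.val + 1 = 1 then (1 : L) else 0)).Local v → ((cmDatum L 2 (Matrix.of fun i j : Fin 2 => if i.val + j.val + 1 = 2 then (1 : L) else 0)).Local v × (cmDatum L 1 (Matrix.of fun i j : Fin 1 => if i.val + j.val + 1 = 1 then (1 : L) else 0)).Local v) ⧸ Subgroup.centralizer ({(u, 1) * z} : Set ((cmDatum L 2 (Matrix.of fun i j : Fin 2 => if i.val + j.val + 1 = 2 then (1 : L) else 0)).Local v × (cmDatum L 1 (Matrix.of fun i j : Fin 1 => if i.val + j.val + 1 = 1 then (1 : L) else 0)).Local v))) '' ((K : Set ((cmDatum L 2 (Matrix.of fun i j : Fin 2 => if i.val + j.val + 1 = 2 then (1 : L)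 else 0)).Local v × (cmDatum L 1 (Matrix.of fun i j : Fin 1 => if i.val + j.val + 1 = 1 then (1 : L) else 0)).Local v)) * {((g n, 1) : (cmDatum L 2 (Matrix.of fun i j : Fin 2 => if i.val + j.val + 1 = 2 then (1 : L) else 0)).Local v × (cmDatum L 1 (Matrix.of fun i j : Fin 1 => if i.val + j.val + 1 = 1 then (1 : L) else 0)).Local v)})) < ⊤ :=
    measure_biUnion_lt_top (Finset.Icc 1 (Mb - nt).toNat).finite_toSet fun n _ =>
      measure_image_mk_mul_singleton_lt_top (Subgroup.centralizer ({(u, 1) * z} : Set ((cmDatum L 2 (Matrix.of fun i j : Fin 2 => if i.val + j.val + 1 = 2 then (1 : L) else 0)).Local v × (cmDatum L 1 (Matrix.of fun i j : Fin 1 => if i.val + j.val + 1 = 1 then (1 : L) else 0)).Local v))) ρ μ ν K hKo hKc _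
  exact lt_of_le_of_lt (measure_mono hcover) ((measure_union_le _ _).trans_lt (ENNReal.add_lt_top.2 ⟨hA, hB⟩))

/-- **RANGA RAO AT THE REGULAR-UNIPOTENT CLASSES OVER A CENTRAL `z` — THE RAO CLAUSE AT THE BASE POINT `(u,1)·z`.**  Same data: for EVERY `H_v`-invariant measure `μ` on
`H_v ⧸ Z((u,1)·z)` finite on compacta and EVERY `f ∈ C_c^∞(H_v)` (★ `IsLocSmooth`), the orbital integrand `y Z ↦ f(y (u,1) z y⁻¹)` is `μ`-integrable
(★ `integrable_descConj_of_measure_preimage_lt_top` over the finiteness theorem above). [cite: Rao1972, Theorem p. 505] [cite: Rogawski1990, §4.9 p. 54; §8.1 p. 112]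
[cite: HarishChandra1999AdmissibleDistributions, §3.1 p. 17] -/
theorem UnitaryGroup.integrable_descConj_of_isLocSmooth_of_coe_eq_lineUnipotent_central
    (L : Type) [Field L] [NumberField L] [IsCMField L] (v : HeightOneSpectrum (𝓞 ↥(maximalRealSubfield L)))
    (w : PlacesOver L v) (hw : IsCMField.complexConj L • w.1 = w.1)
    [MeasurableSpace ((cmDatum L 2 (Matrix.of fun i j : Fin 2 => if i.val + j.val + 1 = 2 then (1 : L) else 0)).Local v × (cmDatum L 1 (Matrix.of fun i j : Fin 1 => if i.val + j.val + 1 = 1 then (1 : L) else 0)).Local v)] [BorelSpace ((cmDatum L 2 (Matrix.of fun i j : Fin 2 => if i.val + j.val + 1 = 2 then (1 : L) else 0)).Local v × (cmDatum L 1 (Matrix.of fun i j : Fin 1 => if i.val + j.val + 1 = 1 then (1 : L) else 0)).Local v)]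
    [∀ γ : (cmDatum L 2 (Matrix.of fun i j : Fin 2 => if i.val + j.val + 1 = 2 then (1 : L) else 0)).Local v × (cmDatum L 1 (Matrix.of fun i j : Fin 1 => if i.val + j.val + 1 = 1 then (1 : L) else 0)).Local v, MeasurableSpace (((cmDatum L 2 (Matrix.of fun i j : Fin 2 => if i.val + j.val + 1 = 2 then (1 : L) else 0)).Local v × (cmDatum L 1 (Matrix.of fun i j : Fin 1 => if i.val + j.val + 1 = 1 then (1 : L) else 0)).Local v) ⧸ Subgroup.centralizer ({γ} : Set ((cmDatum L 2 (Matrix.of fun i j : Fin 2 => if i.val + j.val + 1 = 2 then (1 : L) else 0)).Local v × (cmDatum L 1 (Matrix.of fun i j : Fin 1 => if i.val + j.val + 1 = 1 then (1 : L) else 0)).Local v)))]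
    [∀ γ : (cmDatum L 2 (Matrix.of fun i j : Fin 2 => if i.val + j.val + 1 = 2 then (1 : L) else 0)).Local v × (cmDatum L 1 (Matrix.of fun i j : Fin 1 => if i.val + j.val + 1 = 1 then (1 : L) else 0)).Local v, BorelSpace (((cmDatum L 2 (Matrix.of fun i j : Fin 2 => if i.val + j.val + 1 = 2 then (1 : L) else 0)).Local v × (cmDatum L 1 (Matrix.of fun i j : Fin 1 => if i.val + j.val + 1 = 1 then (1 : L) else 0)).Local v) ⧸ Subgroup.centralizer ({γ} : Set ((cmDatum L 2 (Matrix.of fun i j : Fin 2 => if i.val + j.val + 1 = 2 then (1 : L) else 0)).Local v × (cmDatum L 1 (Matrix.of fun i j : Fin 1 => if i.val + j.val + 1 = 1 then (1 : L) else 0)).Local v)))]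
    (z : (cmDatum L 2 (Matrix.of fun i j : Fin 2 => if i.val + j.val + 1 = 2 then (1 : L) else 0)).Local v × (cmDatum L 1 (Matrix.of fun i j : Fin 1 => if i.val + j.val + 1 = 1 then (1 : L) else 0)).Local v) (hz : z ∈ Subgroup.center ((cmDatum L 2 (Matrix.of fun i j : Fin 2 => if i.val + j.val + 1 = 2 then (1 : L) else 0)).Local v × (cmDatum L 1 (Matrix.of fun i j : Fin 1 => if i.val + j.val + 1 = 1 then (1 : L) else 0)).Local v))
    (u : (cmDatum L 2 (Matrix.of fun i j : Fin 2 => if i.val + j.val + 1 = 2 then (1 : L) else 0)).Local v) {t₀ : w.1.adicCompletion L} (ht₀ : t₀ ≠ 0)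
    (hu : (((localNonsplitEquiv (IsCMField.complexConj L) (Matrix.of fun i j : Fin 2 => if i.val + j.val + 1 = 2 then (1 : L) else 0) (IsCMField.complexConj_ne_one L) w hw u : ↥(unitaryGroupOfForm (galAdicCompletionMap (L := L) (IsCMField.complexConj L) hw) (placeForm (Matrix.of fun i j : Fin 2 => if i.val + j.val + 1 = 2 then (1 : L) else 0) w.1))) : GL (Fin 2) (w.1.adicCompletion L)) : Matrix (Fin 2) (Fin 2) (w.1.adicCompletion L)) = !![1, t₀; 0, 1])
    (μ : Measure (((cmDatum L 2 (Matrix.of fun i j : Fin 2 => if i.val + j.val + 1 = 2 then (1 : L) else 0)).Local v × (cmDatum L 1 (Matrix.of fun i j : Fin 1 => if i.val + j.val + 1 = 1 then (1 : L) else 0)).Local v) ⧸ Subgroup.centralizer ({(u, 1) * z} : Set ((cmDatum L 2 (Matrix.of fun i j : Fin 2 => if i.val + j.val + 1 = 2 then (1 : L) else 0)).Local v × (cmDatum L 1 (Matrix.of fun i j : Fin 1 => if i.val + j.val + 1 = 1 then (1 : L) else 0)).Local v))))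
    [SMulInvariantMeasure ((cmDatum L 2 (Matrix.of fun i j : Fin 2 => if i.val + j.val + 1 = 2 then (1 : L) else 0)).Local v × (cmDatum L 1 (Matrix.of fun i j : Fin 1 => if i.val + j.val + 1 = 1 then (1 : L) else 0)).Local v) _ μ] [IsFiniteMeasureOnCompacts μ]
    (f : (cmDatum L 2 (Matrix.of fun i j : Fin 2 => if i.val + j.val + 1 = 2 then (1 : L) else 0)).Local v × (cmDatum L 1 (Matrix.of fun i j : Fin 1 => if i.val + j.val + 1 = 1 then (1 : L) else 0)).Local v → ℂ) (hf : IsLocSmooth f) :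
    Integrable (descConj ((u, 1) * z) (Subgroup.centralizer ({(u, 1) * z} : Set ((cmDatum L 2 (Matrix.of fun i j : Fin 2 => if i.val + j.val + 1 = 2 then (1 : L) else 0)).Local v × (cmDatum L 1 (Matrix.of fun i j : Fin 1 => if i.val + j.val + 1 = 1 then (1 : L) else 0)).Local v))) (fun _ hg => Subgroup.mem_centralizer_singleton_iff.1 hg) f) μ :=
  integrable_descConj_of_measure_preimage_lt_top ((u, 1) * z) _ _ μ
    (fun _ hC => UnitaryGroup.measure_preimage_descConj_lt_top_of_coe_eq_lineUnipotent_central L v w hw z hz u ht₀ hu μ hC)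
    hf.isLocallyConstant.continuous hf.hasCompactSupport

end Literature.NumberTheory.Rogawski1990

end
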